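import Literature.NumberTheory.EllipticCurves.FormalGroupQuasiPeriodCocycleIntegralProofs
import Literature.NumberTheory.EllipticCurves.FormalGroupEndomorphismsUniversalProofs
import HarnessLib

/-!
# The multiplication defect of the quasi-period function: `η₀([n]X) = n·η₀(X) + R_n(X)` with `R_n`
# integral, and its coboundary `R_n(u ⊕ v) − R_n(u) − R_n(v) = C₀([n]u, [n]v) − n·C₀(u, v)`

Topic `Literature/NumberTheory/EllipticCurves`. For a Weierstrass equation `V` over a `ℚ`-algebra with quasi-period
function `η₀ = formalQuasiPeriod` and addition cocycle `C₀(u,v) = η₀(u +_F v) − η₀(u) − η₀(v)`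
(`FormalGroupQuasiPeriod`), iterating the cocycle along `[k+1](X) = F([k](X), X)` gives

  `η₀([n](X)) = n·η₀(X) + R_n(X)`,  `R_n(X) := Σ_{k<n} C₀([k](X), X)`     (`formalQuasiPeriod_subst_formalMul`)

(`formalQuasiPeriodMulDefect V n = R_n`, the **multiplication defect**), and applying the coboundary operator,

  `R_n(u +_F v) − R_n(u) − R_n(v) = C₀([n]u, [n]v) − n·C₀(u, v)`     (`formalQuasiPeriodMulDefect_cocycle`)

(`[n]` is an endomorphism of `F`, tree `formalMul_subst_formalGroupLaw'`). Since `C₀` and `[k]` are integral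
(`exists_map_eq_formalQuasiPeriodCocycle`, `map_formalMul`), so is `R_n` (`exists_map_eq_formalQuasiPeriodMulDefect`).

Why (BSD crux K★ `stmt-BirchSwinnertonDyer-22226`, hDR sector (iii), the `η`-PERIOD of the Weierstrass formal group
without Banach spaces): for a `p`-power-compatible sequence of torsion points `t = (uᵢ)` with Fontaine elements
`Tᵢ = [t⁽ⁱ⁾] ∈ 𝔸_inf` of the shifted sequences (`[p]T_{i+1} = Tᵢ`, `T₀ ∈ ker θ`), the telescoping identity
`pⁿη₀(ûₙ) = η₀([pⁿ]ûₙ) − Σ_{j<n} p^{n−1−j}R_p([pʲ]ûₙ)` says that Colmez's `∫_t η = lim pⁿ η₀(ûₙ)` is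

  `∫_t η = η₀(T₀) − Σ_{i≥1} p^{i−1} R_p(Tᵢ)`,

the first term a `ξ`-adic evaluation on `Fil¹B_dR⁺` (as for `∫_t ω = log_W(T₀)`), the second a `(p, ξ)`-adically
convergent series of INTEGRAL terms in `𝔸_inf`; the coboundary identity with `n = p` makes this additive in `t`
(`Σ p^{i−1}(C₀(T_{i−1}, T′_{i−1}) − pC₀(Tᵢ, T′ᵢ))` telescopes to `C₀(T₀, T′₀)`), and `θ(∫_t η) = −Σ p^{i−1}R_p(uᵢ)`.
BSD is not proved by any of this.

## References
* N. M. Katz, *Crystalline cohomology, Dieudonné modules, and Jacobi sums* (1981), §5.1 (quasi-logarithms, the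
  coboundary `∂f`). [Katz1981CrystallineDieudonne]
* P. Colmez, *Périodes p-adiques des variétés abéliennes*, Math. Ann. 292 (1992), §2. [Colmez1992PeriodesAbeliennes]
* J. H. Silverman, *The Arithmetic of Elliptic Curves* (2009), IV.2.3 (`[m]`, `[m] ∘ F = F ∘ ([m] × [m])`). [SilvermanAEC2009]
-/

noncomputable section

open PowerSeries Literature.NumberTheory.EllipticCurves

namespace WeierstrassCurve

section RatAlgebra

variable {A : Type*} [CommRing A] [Algebra ℚ A] (V : WeierstrassCurve A)

/-- **The multiplication defect `R_n(X) = Σ_{k<n} C₀([k](X), X) ∈ A⟦X⟧`** of the quasi-period function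
(`η₀([n]X) = n·η₀(X) + R_n(X)`, `formalQuasiPeriod_subst_formalMul`). [cite: Katz1981CrystallineDieudonne, §5.1] -/
def formalQuasiPeriodMulDefect (n : ℕ) : A⟦X⟧ :=
  ∑ k ∈ Finset.range n, MvPowerSeries.subst ![V.formalMul k, (X : A⟦X⟧)] V.formalQuasiPeriodCocycle

/-- `R_0 = 0`. [cite: Katz1981CrystallineDieudonne, §5.1] -/
@[simp] theorem formalQuasiPeriodMulDefect_zero : V.formalQuasiPeriodMulDefect 0 = 0 := by
  simp [formalQuasiPeriodMulDefect]

/-- `R_{n+1} = R_n + C₀([n]X, X)`. [cite: Katz1981CrystallineDieudonne, §5.1] -/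
theorem formalQuasiPeriodMulDefect_succ (n : ℕ) :
    V.formalQuasiPeriodMulDefect (n + 1) =
      V.formalQuasiPeriodMulDefect n + MvPowerSeries.subst ![V.formalMul n, (X : A⟦X⟧)] V.formalQuasiPeriodCocycle := by
  rw [formalQuasiPeriodMulDefect, Finset.sum_range_succ, formalQuasiPeriodMulDefect]

/-- The cocycle read along `([n]X, X)`: `C₀([n]X, X) = η₀([n+1]X) − η₀([n]X) − η₀(X)`.
[cite: Katz1981CrystallineDieudonne, §5.1] -/
theorem subst_formalMul_X_formalQuasiPeriodCocycle (n : ℕ) :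
    MvPowerSeries.subst ![V.formalMul n, (X : A⟦X⟧)] V.formalQuasiPeriodCocycle =
      V.formalQuasiPeriod.subst (V.formalMul (n + 1)) - V.formalQuasiPeriod.subst (V.formalMul n) -
        V.formalQuasiPeriod := by
  have hs : MvPowerSeries.HasSubst ![V.formalMul n, (X : A⟦X⟧)] := hasSubst_pair_X (V.constantCoeff_formalMul n)
  rw [formalQuasiPeriodCocycle_def, MvPowerSeries.subst_sub hs, MvPowerSeries.subst_sub hs,
    mvSubst_powerSeries_subst V.hasSubst_formalGroupLaw hs,
    mvSubst_powerSeries_subst (PowerSeries.HasSubst.X 0) hs, mvSubst_powerSeries_subst (PowerSeries.HasSubst.X 1) hs,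
    MvPowerSeries.subst_X hs, MvPowerSeries.subst_X hs, ← formalMul_succ]
  show V.formalQuasiPeriod.subst (V.formalMul (n + 1)) - V.formalQuasiPeriod.subst (V.formalMul n) -
    V.formalQuasiPeriod.subst (X : A⟦X⟧) = _
  rw [PowerSeries.X_subst]

/-- **`η₀([n]X) = n·η₀(X) + R_n(X)`** (iterate the addition cocycle along `[k+1]X = [k]X ⊕ X`).
[cite: Katz1981CrystallineDieudonne, §5.1] -/
theorem formalQuasiPeriod_subst_formalMul (n : ℕ) :
    V.formalQuasiPeriod.subst (V.formalMul n) = (n : A⟦X⟧) * V.formalQuasiPeriod + V.formalQuasiPeriodMulDefect n := by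
  induction n with
  | zero =>
    rw [formalMul_zero, formalQuasiPeriodMulDefect_zero, Nat.cast_zero, zero_mul, add_zero]
    exact PowerSeries.subst_zero_of_constantCoeff_zero V.constantCoeff_formalQuasiPeriod
  | succ n ih =>
    rw [formalQuasiPeriodMulDefect_succ, subst_formalMul_X_formalQuasiPeriodCocycle, ih, Nat.cast_succ]
    ring

end RatAlgebra

/-! ### The coboundary of the multiplication defect -/

section Coboundary

variable {A : Type*} [CommRing A] [Algebra ℚ A] (V : WeierstrassCurve A)

/-- `η₀([n](u +_F v)) − η₀([n]u) − η₀([n]v) = C₀([n]u, [n]v)`: `[n]` is an endomorphism of `F`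
(`formalMul_subst_formalGroupLaw'`) and `C₀` is the addition cocycle. [cite: SilvermanAEC2009, IV.2.3] -/
theorem formalQuasiPeriod_subst_formalMul_subst_formalGroupLaw (n : ℕ) :
    PowerSeries.subst V.formalGroupLaw (V.formalQuasiPeriod.subst (V.formalMul n)) -
        PowerSeries.subst (MvPowerSeries.X 0 : MvPowerSeries (Fin 2) A) (V.formalQuasiPeriod.subst (V.formalMul n)) -
        PowerSeries.subst (MvPowerSeries.X 1 : MvPowerSeries (Fin 2) A) (V.formalQuasiPeriod.subst (V.formalMul n)) =
      MvPowerSeries.subst ![(V.formalMul n).subst (MvPowerSeries.X 0 : MvPowerSeries (Fin 2) A),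
        (V.formalMul n).subst (MvPowerSeries.X 1 : MvPowerSeries (Fin 2) A)] V.formalQuasiPeriodCocycle := by
  have hn0 := V.constantCoeff_formalMul n
  have hF := V.hasSubst_formalGroupLaw
  have hmn : PowerSeries.HasSubst (V.formalMul n) := PowerSeries.HasSubst.of_constantCoeff_zero hn0
  have h0 : MvPowerSeries.constantCoeff ((V.formalMul n).subst (MvPowerSeries.X 0 : MvPowerSeries (Fin 2) A)) = 0 :=
    constantCoeff_powerSeries_subst_eq_zero (MvPowerSeries.constantCoeff_X 0) hn0
  have h1 : MvPowerSeries.constantCoeff ((V.formalMul n).subst (MvPowerSeries.X 1 : MvPowerSeries (Fin 2) A)) = 0 :=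
    constantCoeff_powerSeries_subst_eq_zero (MvPowerSeries.constantCoeff_X 1) hn0
  have hpair : MvPowerSeries.HasSubst ![(V.formalMul n).subst (MvPowerSeries.X 0 : MvPowerSeries (Fin 2) A),
      (V.formalMul n).subst (MvPowerSeries.X 1 : MvPowerSeries (Fin 2) A)] := hasSubst_pair h0 h1
  -- `(η₀ ∘ [n])(F) = η₀([n](F)) = η₀(F([n]u, [n]v))`
  rw [PowerSeries.subst_comp_subst_apply hmn hF, PowerSeries.subst_comp_subst_apply hmn (PowerSeries.HasSubst.X 0),
    PowerSeries.subst_comp_subst_apply hmn (PowerSeries.HasSubst.X 1), V.formalMul_subst_formalGroupLaw' n,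
    formalQuasiPeriodCocycle_def, MvPowerSeries.subst_sub hpair, MvPowerSeries.subst_sub hpair,
    mvSubst_powerSeries_subst hF hpair, mvSubst_powerSeries_subst (PowerSeries.HasSubst.X 0) hpair,
    mvSubst_powerSeries_subst (PowerSeries.HasSubst.X 1) hpair, MvPowerSeries.subst_X hpair, MvPowerSeries.subst_X hpair]
  rfl

/-- **The coboundary of the multiplication defect**: `R_n(u +_F v) − R_n(u) − R_n(v) = C₀([n]u, [n]v) − n·C₀(u, v)`
(apply the coboundary operator to `η₀ ∘ [n] = n·η₀ + R_n`). [cite: Katz1981CrystallineDieudonne, §5.1] -/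
theorem formalQuasiPeriodMulDefect_cocycle (n : ℕ) :
    (V.formalQuasiPeriodMulDefect n).subst V.formalGroupLaw -
        (V.formalQuasiPeriodMulDefect n).subst (MvPowerSeries.X 0 : MvPowerSeries (Fin 2) A) -
        (V.formalQuasiPeriodMulDefect n).subst (MvPowerSeries.X 1 : MvPowerSeries (Fin 2) A) =
      MvPowerSeries.subst ![(V.formalMul n).subst (MvPowerSeries.X 0 : MvPowerSeries (Fin 2) A),
          (V.formalMul n).subst (MvPowerSeries.X 1 : MvPowerSeries (Fin 2) A)] V.formalQuasiPeriodCocycle -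
        (n : MvPowerSeries (Fin 2) A) * V.formalQuasiPeriodCocycle := by
  have key := V.formalQuasiPeriod_subst_formalMul_subst_formalGroupLaw n
  have hR : V.formalQuasiPeriodMulDefect n = V.formalQuasiPeriod.subst (V.formalMul n) - (n : A⟦X⟧) * V.formalQuasiPeriod := by
    rw [V.formalQuasiPeriod_subst_formalMul n]; ring
  have hF := V.hasSubst_formalGroupLaw
  have e : ∀ {g : MvPowerSeries (Fin 2) A} (hg : PowerSeries.HasSubst g),
      (V.formalQuasiPeriodMulDefect n).subst g =
        PowerSeries.subst g (V.formalQuasiPeriod.subst (V.formalMul n)) -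
          (n : MvPowerSeries (Fin 2) A) * V.formalQuasiPeriod.subst g := by
    intro g hg
    rw [hR, ← PowerSeries.coe_substAlgHom hg, map_sub, map_mul, map_natCast]
  rw [e hF, e (PowerSeries.HasSubst.X 0), e (PowerSeries.HasSubst.X 1), ← key, formalQuasiPeriodCocycle_def]
  ring

end Coboundary

/-! ### Integrality of the multiplication defect -/

section Integral

variable {R A : Type*} [CommRing R] [IsDomain R] [CommRing A] [IsDomain A] [Algebra ℚ A] {φ : R →+* A}
  (hφ : Function.Injective φ) (W : WeierstrassCurve R)
include hφ

/-- **`R_n` is integral**: for `W` over a domain `R ↪ A`, `R_n(W ⊗ A) = Σ_{k<n} C₀([k]X, X)` is the image of a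
series with coefficients in `R` (`C₀` and `[k]` are). [cite: Katz1981CrystallineDieudonne, §5.1] -/
theorem exists_map_eq_formalQuasiPeriodMulDefect (n : ℕ) :
    ∃ Rn : R⟦X⟧, PowerSeries.map φ Rn = (W.map φ).formalQuasiPeriodMulDefect n := by
  obtain ⟨C, hC⟩ := W.exists_map_eq_formalQuasiPeriodCocycle hφ
  refine ⟨∑ k ∈ Finset.range n, MvPowerSeries.subst ![W.formalMul k, (X : R⟦X⟧)] C, ?_⟩
  rw [formalQuasiPeriodMulDefect, map_sum]
  refine Finset.sum_congr rfl fun k _ => ?_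
  have hs : MvPowerSeries.HasSubst ![W.formalMul k, (X : R⟦X⟧)] := hasSubst_pair_X (W.constantCoeff_formalMul k)
  rw [show PowerSeries.map φ (MvPowerSeries.subst ![W.formalMul k, (X : R⟦X⟧)] C) =
      MvPowerSeries.map φ (MvPowerSeries.subst ![W.formalMul k, (X : R⟦X⟧)] C) from rfl,
    MvPowerSeries.map_subst hs, hC]
  congr 1
  funext i
  fin_cases i
  · exact W.map_formalMul φ k
  · exact PowerSeries.map_X φ

end Integral

end WeierstrassCurve
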